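import Literature.NumberTheory.Automorphic.EichlerSelbergLevelOneHurwitz
import HarnessLib

set_option linter.dupNamespace false -- `Summit.BirchSwinnertonDyer.BirchSwinnertonDyer.Theorems.…` (summit = sub, D-0017)
set_option autoImplicit false

/-!
# Crux `HeegnerTwistCouplingInSupply` (stmt-BirchSwinnertonDyer-21381) — the Frobenius fan, III: THE CHARACTER-TWISTED FAN SUM IS A
# HECKE TRACE (modulo the tree's named trace-formula fact at level `27`): for a primitive even Dirichlet character `χ` mod `27` and a
# prime `p ≡ 2 (mod 3)`, `Σ_{t² < 4p} c_χ(t, p)·H(4p − t²) = −2·Tr(T_p | S₂(Γ₀(27), χ)) − 2(1 + χ(p))`,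
# `c_χ(t, p) = Σ_{x mod 27, x² − tx + p ≡ 0 (27)} χ(x)` (card `chebotarev-digit-supply`, cruxidea seat 1 g38: the engine `SliceFormula27`)

Route `BiquadraticEisensteinDescent` (cell `pub/bsd-wall`, width seat `bsd-wall-cm-bed-w4` g30; `--supports` 21381, helper). THEOREMS ONLY
(no `def`, no named fact, no `sorry`). BSD is not proved by any of this; the crux (residual C⁺) and its registered stubs are untouched.

The card's digit is Frobenian because the `χ`-twisted fan sums `Σ_t c_χ(t,p) H(4p − t²)` are, up to the hyperbolic term `−(1 + χ(p))`,
traces of `T_p` on `S₂(Γ₀(27), χ)` (Eichler–Selberg with nebentypus; the slices `N₂₇(p, τ) = Σ_{t ≡ τ (27)} H(4p − t²)` follow by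
orthogonality over the characters mod `27`). This file TRANSCRIBES that from the tree's named fact
`Literature.NumberTheory.Automorphic.HeckeTraceFormulaGL2Level 27 χ 2` (Schoof–van der Vlugt Thm. 2.2 = Cohen–Oesterlé; an unproved
`def … : Prop`, taken as the hypothesis `hTF` exactly as in `EichlerSelbergLevelOneHurwitz.sum_hurwitzClassNumber_eq_of_traceFormula`):

* §1 the four terms at `(N, k, n) = (27, 2, p)`, `p ≡ 2 (mod 3)` prime, `χ` of conductor `27`: `A₁ = 0` (`p` is not a square),
  `A₄ = 0` (`χ ≠ 1`), `A₃ = −(1 + χ(p))` (only `d = 1` and `c ∈ {1, 27}` survive; `χ(y) = χ(p)`, resp. `χ(1)`), and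
  `A₂ = −½ Σ_{t² < 4p} c_χ(t, p)·H(4p − t²)` — every conductor `f` of `t² − 4p` is prime to `3` (`t² − 4p ≢ 0 (mod 3)`), so the local
  density `μ(t, f, p)` is the plain root sum `c_χ(t, p)`, independent of `f`, and `Σ_f h_w((t² − 4p)/f²) = H(4p − t²)`
  (`hurwitzClassNumber_eq_sum_ellipticConductors`);
* §2 ★ `sum_rootCharSum_mul_hurwitz_eq_of_traceFormula` — the identity above, modulo `hTF`.

HONEST FRAMING: conditional on the named fact (not proved in the tree); the spectral object `cuspidalHeckeTrace 27 2 χ p` is the tree's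
abstract trace of `T_p` on the nebentypus subspace — its reading as a Frobenius trace of `J₁(27)` (Eichler–Shimura) and Chebotarev are NOT
in the tree. The card's own `SliceFormula27` keeps only the roots `x ≡ 1 (mod 3)`; here both roots are summed (the printed `μ`).
[cite: SchoofVandervlugt1991, Thm. 2.2, p. 168] [cite: Cohen1993, §5.3.2 Lemma 5.3.7, p. 234]
-/

noncomputable section

open Finset
open scoped Classical

namespace Summit.BirchSwinnertonDyer.BirchSwinnertonDyer.Theorems.FrobeniusFan

open Literature.NumberTheory.Automorphic Literature.NumberTheory.Automorphic.HeckeTraceFormulaGL2Level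
open Literature.NumberTheory.Automorphic.Brandt
open Literature.NumberTheory.QuadraticFields (hurwitzClassNumber hurwitzClassNumber_eq_sum_ellipticConductors)

/-! ## §1 The four terms of the geometric side at `(27, χ, 2)`, `n = p ≡ 2 (mod 3)` -/

section Terms

variable (χ : DirichletCharacter ℂ 27)

/-- **`A₁ = 0` at `n = p` prime** (a prime is not a square, Mathlib `Prime.not_isSquare`). [cite: SchoofVandervlugt1991, Thm. 2.2 (A₁), p. 168] -/
theorem identityTerm_prime (k : ℤ) {p : ℕ} (hp : p.Prime) : identityTerm 27 χ k p = 0 :=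
  identityTerm_of_not_isSquare 27 χ k hp.prime.not_isSquare

/-- **`A₄ = 0` for a character of conductor `27`** (`χ ≠ 1`). [cite: SchoofVandervlugt1991, Thm. 2.2 (A₄), p. 168] -/
theorem parabolicTerm_of_conductor (hcond : χ.conductor = 27) (k : ℤ) (n : ℕ) : parabolicTerm 27 χ k n = 0 := by
  refine parabolicTerm_of_ne_one 27 χ k (fun h1 ↦ ?_) n
  rw [h1, DirichletCharacter.conductor_one] at hcond
  exact absurd hcond (by norm_num)

/-- `ψ(N) > 0`. [cite: SchoofVandervlugt1991, Thm. 2.2 (definition of ψ(N)), p. 168] -/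
theorem dedekindPsi_pos {N : ℕ} (hN : 0 < N) : 0 < dedekindPsi N := by
  unfold dedekindPsi
  refine mul_pos (by exact_mod_cast hN) (Finset.prod_pos fun q _ ↦ ?_)
  positivity

/-- The CRT value with `c = 1`, `e = N`: `χ(y) = χ(b)` (`y ≡ b (mod N)`). [cite: SchoofVandervlugt1991, Thm. 2.2 (A₃), p. 168] -/
theorem crtCharValue_one_left {N : ℕ} [NeZero N] (ψ : DirichletCharacter ℂ N) (a b : ℕ) :
    crtCharValue N ψ 1 N a b = ψ (b : ZMod N) := by
  unfold crtCharValue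
  have h : ∃ y : ℕ, ((1 : ℕ) : ℤ) ∣ (y : ℤ) - a ∧ ((N : ℕ) : ℤ) ∣ (y : ℤ) - b := ⟨b, by simp, by simp⟩
  rw [dif_pos h]
  congr 1
  have hy := (Nat.find_spec h).2
  have : ((b : ℤ) : ZMod N) = ((Nat.find h : ℕ) : ℤ) :=
    (ZMod.intCast_eq_intCast_iff_dvd_sub (b : ℤ) (Nat.find h : ℕ) N).2 hy
  simpa using this.symm

/-- The CRT value with `c = N`, `e = 1`: `χ(y) = χ(a)` (`y ≡ a (mod N)`). [cite: SchoofVandervlugt1991, Thm. 2.2 (A₃), p. 168] -/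
theorem crtCharValue_one_right {N : ℕ} [NeZero N] (ψ : DirichletCharacter ℂ N) (a b : ℕ) :
    crtCharValue N ψ N 1 a b = ψ (a : ZMod N) := by
  unfold crtCharValue
  have h : ∃ y : ℕ, ((N : ℕ) : ℤ) ∣ (y : ℤ) - a ∧ ((1 : ℕ) : ℤ) ∣ (y : ℤ) - b := ⟨a, by simp, by simp⟩
  rw [dif_pos h]
  congr 1
  have hy := (Nat.find_spec h).1
  have : ((a : ℤ) : ZMod N) = ((Nat.find h : ℕ) : ℤ) :=
    (ZMod.intCast_eq_intCast_iff_dvd_sub (a : ℤ) (Nat.find h : ℕ) N).2 hy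
  simpa using this.symm

/-- The `d`-range of `A₃` at a prime `n = p`: only `d = 1` has `d ∣ p`, `d² ≤ p`. [folklore] -/
theorem divisors_filter_prime {p : ℕ} (hp : p.Prime) : p.divisors.filter (fun d ↦ d * d ≤ p) = {1} := by
  ext d
  simp only [Finset.mem_filter, Nat.mem_divisors, Finset.mem_singleton]
  constructor
  · rintro ⟨⟨hd, -⟩, hle⟩
    rcases (Nat.dvd_prime hp).1 hd with rfl | rfl
    · rfl
    · have := hp.two_le; nlinarith
  · rintro rfl
    exact ⟨⟨one_dvd _, hp.ne_zero⟩, by simpa using hp.one_le⟩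

/-- The `c`-range of `A₃` at level `27` for a character of conductor `27`: `gcd(c, 27/c) ∣ 1` leaves `c ∈ {1, 27}`.
[cite: SchoofVandervlugt1991, Thm. 2.2 (A₃), p. 168] -/
theorem divisors_filter_level27 (hcond : χ.conductor = 27) (m : ℤ) :
    (27 : ℕ).divisors.filter (fun c ↦ Nat.gcd c (27 / c) ∣ 27 / χ.conductor ∧ (Nat.gcd c (27 / c) : ℤ) ∣ m) = {1, 27} := by
  rw [hcond]
  ext c
  simp only [Finset.mem_filter, Nat.mem_divisors, Finset.mem_insert, Finset.mem_singleton]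
  constructor
  · rintro ⟨⟨hc, -⟩, h1, -⟩
    obtain ⟨i, hi, rfl⟩ := (Nat.dvd_prime_pow Nat.prime_three).1 (show c ∣ 3 ^ 3 by simpa using hc)
    interval_cases i
    · left; rfl
    · exfalso; revert h1; decide
    · exfalso; revert h1; decide
    · right; rfl
  · rintro (rfl | rfl)
    · exact ⟨⟨one_dvd _, by norm_num⟩, by simp, by simp⟩
    · exact ⟨⟨dvd_rfl, by norm_num⟩, by simp, by simp⟩

/-- **`A₃ = −(1 + χ(p))` at `(27, χ, 2)`, `n = p` prime, `χ` of conductor `27`** (the divisor pair `(1, p)`; `c = 1` gives `χ(p)`,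
`c = 27` gives `χ(1) = 1`). [cite: SchoofVandervlugt1991, Thm. 2.2 (A₃), p. 168] -/
theorem hyperbolicTerm_level27_prime (hcond : χ.conductor = 27) {p : ℕ} (hp : p.Prime) :
    hyperbolicTerm 27 χ 2 p = -(1 + χ (p : ZMod 27)) := by
  unfold hyperbolicTerm
  rw [divisors_filter_prime hp, Finset.sum_singleton, if_neg (by simpa using hp.one_lt.ne), Nat.div_one,
    divisors_filter_level27 χ hcond, Finset.sum_pair (by norm_num)]
  simp only [Nat.div_one, Nat.gcd_one_left, Nat.totient_one, Nat.cast_one, one_mul, Nat.div_self (by norm_num : 0 < 27),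
    Nat.gcd_one_right]
  rw [crtCharValue_one_left χ 1 p, crtCharValue_one_right χ 1 p]
  push_cast
  rw [map_one]
  ring

/-- **No conductor of `t² − 4p` is divisible by `3` when `p ≡ 2 (mod 3)`** (`t² − 4p ≡ t² + 1 ≢ 0 (mod 3)`).
[cite: Cox2013, §7.A (7.2)–(7.3)] -/
theorem not_three_dvd_of_mem_ellipticConductors {p : ℕ} (hp3 : p % 3 = 2) {t : ℤ} (h : t ^ 2 < 4 * (p : ℤ)) {f : ℕ}
    (hf : f ∈ ellipticConductors t p) : ¬ 3 ∣ f := by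
  intro h3
  obtain ⟨-, hdvd, -⟩ := (mem_ellipticConductors_iff h).1 hf
  have h9 : (3 : ℤ) ∣ t ^ 2 - 4 * p :=
    (dvd_pow (Int.natCast_dvd_natCast.mpr h3) two_ne_zero).trans hdvd
  have hz : ((t ^ 2 - 4 * (p : ℤ) : ℤ) : ZMod 3) = 0 := (ZMod.intCast_zmod_eq_zero_iff_dvd _ 3).mpr h9
  have hpz : (p : ZMod 3) = 2 := by
    have : (p : ZMod 3) = ((p % 3 : ℕ) : ZMod 3) := by rw [ZMod.natCast_mod]
    rw [this, hp3]; rfl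
  push_cast at hz
  rw [hpz] at hz
  have key : ∀ x : ZMod 3, x ^ 2 - 4 * 2 ≠ 0 := by decide
  exact key _ hz

/-- **The local density is the plain root sum** for a conductor `f` prime to `3` at level `27`:
`μ(t, f, p) = Σ_{x mod 27, 27 ∣ x² − tx + p} χ(x)` (`N_f = 1`, `ψ(27)/ψ(27) = 1`). [cite: SchoofVandervlugt1991, Thm. 2.2 (μ(t,f,n)), p. 168] -/
theorem localDensity_level27_of_not_dvd {f : ℕ} (hf : ¬ 3 ∣ f) (t : ℤ) (n : ℕ) :
    localDensity 27 χ t f n =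
      ∑ x ∈ Finset.range 27, if ((27 : ℕ) : ℤ) ∣ (x : ℤ) ^ 2 - t * x + n then χ (x : ZMod 27) else 0 := by
  have hgcd : Nat.gcd 27 f = 1 := by
    have h3 : Nat.Coprime 3 f := (Nat.Prime.coprime_iff_not_dvd Nat.prime_three).2 hf
    exact Nat.Coprime.pow_left 3 h3
  unfold localDensity
  rw [hgcd, Nat.div_one, mul_one, div_self (dedekindPsi_pos (by norm_num : 0 < 27)).ne']
  push_cast
  rw [one_mul]

/-- **`A₂ = −½ Σ_{t² < 4p} c_χ(t, p)·H(4p − t²)` at `(27, χ, 2)`, `n = p ≡ 2 (mod 3)`** (`archFactor = 1` in weight `2`; the local density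
does not depend on `f`; `Σ_f h_w = H`). [cite: SchoofVandervlugt1991, Prop. 2.1 and Thm. 2.2 (A₂), pp. 165–168] [cite: Cohen1993, §5.3.2 Lemma 5.3.7, p. 234] -/
theorem ellipticTerm_level27_prime {p : ℕ} (hp3 : p % 3 = 2) :
    ellipticTerm 27 χ 2 p =
      -(1 / 2 : ℂ) * ∑ t ∈ (Finset.Icc (-(2 * p : ℤ)) (2 * p)).filter (fun t : ℤ ↦ t ^ 2 < 4 * (p : ℤ)),
        (∑ x ∈ Finset.range 27, if ((27 : ℕ) : ℤ) ∣ (x : ℤ) ^ 2 - t * x + p then χ (x : ZMod 27) else 0) *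
          (hurwitzClassNumber (4 * p - t ^ 2) : ℂ) := by
  unfold ellipticTerm
  congr 1
  refine Finset.sum_congr rfl fun t ht ↦ ?_
  have ht' : t ^ 2 < 4 * (p : ℤ) := (Finset.mem_filter.1 ht).2
  rw [archFactor_two ht', one_mul, hurwitzClassNumber_eq_sum_ellipticConductors ht', Rat.cast_sum, Finset.mul_sum]
  refine Finset.sum_congr rfl fun f hf ↦ ?_
  rw [localDensity_level27_of_not_dvd χ (not_three_dvd_of_mem_ellipticConductors hp3 ht' hf), mul_comm]

end Terms

/-! ## §2 The twisted fan sum is a Hecke trace -/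

section Identity

/-- ★ **THE `χ`-TWISTED FROBENIUS-FAN SUM IS A HECKE TRACE** (modulo the named fact `HeckeTraceFormulaGL2Level 27 χ 2`): for a Dirichlet
character `χ` mod `27` of conductor `27` with `χ(−1) = 1` and a prime `p ≡ 2 (mod 3)`,
`Σ_{t² < 4p} c_χ(t, p)·H(4p − t²) = −2·Tr(T_p | S₂(Γ₀(27), χ)) − 2(1 + χ(p))`, `c_χ(t, p) = Σ_{x mod 27, 27 ∣ x² − tx + p} χ(x)`
— the card's `SliceFormula27` engine with both roots summed (the digit slices `N₂₇(p, τ)` follow by character orthogonality).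
[cite: SchoofVandervlugt1991, Thm. 2.2, p. 168] [cite: Cohen1993, §5.3.2 Lemma 5.3.7, p. 234] -/
theorem sum_rootCharSum_mul_hurwitz_eq_of_traceFormula (χ : DirichletCharacter ℂ 27) (hcond : χ.conductor = 27)
    (heven : χ (-1) = 1) (hTF : HeckeTraceFormulaGL2Level 27 χ 2) {p : ℕ} (hp : p.Prime) (hp3 : p % 3 = 2) :
    ∑ t ∈ (Finset.Icc (-(2 * p : ℤ)) (2 * p)).filter (fun t : ℤ ↦ t ^ 2 < 4 * (p : ℤ)),
        (∑ x ∈ Finset.range 27, if ((27 : ℕ) : ℤ) ∣ (x : ℤ) ^ 2 - t * x + p then χ (x : ZMod 27) else 0) *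
          (hurwitzClassNumber (4 * p - t ^ 2) : ℂ) =
      -2 * cuspidalHeckeTrace 27 2 χ p - 2 * (1 + χ (p : ZMod 27)) := by
  have h := hTF le_rfl (by rw [heven]; norm_num) p hp.pos
  unfold geometricSide at h
  rw [identityTerm_prime χ 2 hp, ellipticTerm_level27_prime χ hp3, hyperbolicTerm_level27_prime χ hcond hp,
    parabolicTerm_of_conductor χ hcond] at h
  linear_combination (2 : ℂ) * h

end Identity

end Summit.BirchSwinnertonDyer.BirchSwinnertonDyer.Theorems.FrobeniusFan
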